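import Summits.CriticalPhenomena.Ising3D.Control2DTaylorSound
import Summits.CriticalPhenomena.Ising3D.Control2DTaylorHalf
import Mathlib.Tactic.Linarith
import Mathlib.Tactic.Positivity
import HarnessLib

/-!
# A 2D γ-certificate at `z = z̄ = 1/2` in explicit form: the finitely many inequalities that close it
(cell `pub-ising3x`, seat controls-1 gen 14; KERNEL PATH for the 2D γ (derivative-functional)
certificates, step 2c — the interface a kernel replay must meet — CONTROL-ONLY)

HONEST FRAMING: lottery ticket; floor = tightest certified 3D Ising CFT bounds; no exact-solution
claim without a proof. CONTROL-ONLY (`d = 2`, axiom set `A2D′`); nothing numerical is asserted here.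

This file assembles the seat's chain into the theorems a successor instantiates with a certificate's
rational table `w` on its index set `S ⊂ ℕ × ℕ` (`φ = taylorFunctional2D (1/2) S w`, the readers'
`α = ∑ α_{mn} ∂_z^m ∂_z̄^n|_{1/2}` with `w_{mn} = m! n! α_{mn}`), threshold `E₀` and ONE truncation
order `N ≥ E₀`:

* `gapExcluded_half_of_explicit` — kind `gap` (`Δ_ε < U`): from (I) `φ[F_-[1]] > 0`, (R) the binomial
  polynomial inequalities `0 ≤ ∑_{p∈S} w_p (1-(-1)^{p₁+p₂}) 2^{p₁+p₂} (q_{b+J}(p₁) q_b(p₂) + q_b(p₁) q_{b+J}(p₂))`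
  for all real `b ≥ 0`, `J ∈ ℕ`, `2b + J ≥ E₀` (`pairPositiveAbove_half_of_poly`), and (C) positivity of
  `φ` on the TRUNCATED blocks `F_-[Q_N(Δ)]` on the scalar cells `U ≤ Δ < E₀` and the spin cells
  `ℓ ≤ Δ < E₀` (even `ℓ ≠ 0`) — to `GapExcluded s U`, for `U > 2s`, `0 ≤ s < 1`;
* `boxObligations_half_of_explicit`, `excludedOn_half_of_explicit`, `boxExcluded_half_of_explicit` —
  kind `box` under `A2D′`: from (I), (R), (E) the `ε` cells `e₁ ≤ Δ ≤ e₂`, (C′) the gapped cells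
  (`ℓ = 0` on `[G, E₀)`, `ℓ = 2` on `[2+δ, E₀)`, even `ℓ ≥ 4` on `[ℓ, E₀)`), (T) the point `(2,2)`, all
  on truncated blocks — to `ExcludedOn s G δ (Icc e₁ e₂)` (every box with `e₁ ≥ 0`; `G > 2s`,
  `s < 1`) and, for `e₁ > 2s`, to `BoxExcluded s G δ e₁ e₂`.

Each remaining hypothesis is a statement about an EXPLICIT finite sum (`taylorFunctional2D_crossF_one`,
`taylorFunctional2D_crossF_QN`, `taylorFunctional2D_half_crossF_pairPow`) — the objects the readers'
exact arithmetic (Bernstein tables in `Δ` per cell, top form + boxes + integer-`j` discharge in the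
region) certifies; replaying those certificates in the kernel is the successor's step (not done here).
Sources: R. Rattazzi, V. S. Rychkov, E. Tonni, A. Vichi, JHEP 12 (2008) 031, §5.5; this seat's files.
-/

namespace Summit.CriticalPhenomena.Ising3D.Control2D

open Finset Set
open Literature.MathematicalPhysics.QuantumFieldTheory.ConformalBootstrap3D

/-- **Kind `gap` at `(1/2,1/2)`, explicit form.** For the table functional
`φ = taylorFunctional2D (1/2) S w`, threshold `E₀` and a truncation order `N` with `E₀ ≤ N`:
(I) `φ[F_-[1]] > 0`, (R) the binomial-polynomial region inequalities, (C) `φ[F_-[Q_N(Δ)]] ≥ 0` on the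
scalar cells `U ≤ Δ < E₀` and on the spin cells `ℓ ≤ Δ < E₀` (even `ℓ ≠ 0`) give `GapExcluded s U`
whenever `2s < U` and `0 ≤ s < 1`. PROVED (assembly of `pairPositiveAbove_half_of_poly`,
`high_nonneg_of_pairPositive_taylor`, `blockPositive_of_QN_nonneg_taylor`, `gapExcluded_taylor`).
[cite: RattazziEtAl2008, §5.5] -/
theorem gapExcluded_half_of_explicit (S : Finset (ℕ × ℕ)) (w : ℕ × ℕ → ℝ) {s U E₀ : ℝ} (N : ℕ)
    (hs0 : 0 ≤ s) (hs1 : s < 1) (hU2 : 2 * s < U) (hN : E₀ ≤ N)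
    (hI : 0 < taylorFunctional2D (1 / 2) S w (crossF s (-1) (fun _ _ => (1 : ℝ))))
    (hR : ∀ (b : ℝ) (J : ℕ), 0 ≤ b → E₀ ≤ 2 * b + J →
      0 ≤ ∑ p ∈ S, w p * ((1 - (-1 : ℝ) ^ (p.1 + p.2)) * 2 ^ (p.1 + p.2) *
        (qFactor₁ s (b + J) p.1 * qFactor₁ s b p.2 + qFactor₁ s b p.1 * qFactor₁ s (b + J) p.2)))
    (hC0 : ∀ Δ : ℝ, U ≤ Δ → Δ < E₀ →
      0 ≤ taylorFunctional2D (1 / 2) S w (crossF s (-1) (QN N 0 Δ)))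
    (hCℓ : ∀ ℓ : ℕ, Even ℓ → ℓ ≠ 0 → ∀ Δ : ℝ, (ℓ : ℝ) ≤ Δ → Δ < E₀ →
      0 ≤ taylorFunctional2D (1 / 2) S w (crossF s (-1) (QN N ℓ Δ))) :
    GapExcluded s U := by
  have hφ := isTaylorFunctional_taylorFunctional2D (1 / 2) S w
  have hx0 : (0 : ℝ) < 1 / 2 := by norm_num
  have hx1 : (1 / 2 : ℝ) < 1 := by norm_num
  have hpair : PairPositiveAbove (taylorFunctional2D (1 / 2) S w) s E₀ :=
    pairPositiveAbove_half_of_poly S w hR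
  refine GapObligations.gapExcluded_taylor (E₀ := E₀) hφ hx0 hx1 hU2 hs1 ⟨hI, ?_, ?_, ?_⟩
  · intro Δ hUΔ hΔE
    refine blockPositive_of_QN_nonneg_taylor hφ hx0 hx1 hpair (ℓ := 0) (N := N) ?_ ?_
      (hC0 Δ hUΔ hΔE)
    · simp only [Nat.cast_zero]; linarith
    · linarith
  · intro ℓ hℓ hℓ0 Δ hℓΔ hΔE
    have : (0 : ℝ) ≤ ℓ := Nat.cast_nonneg ℓ
    exact blockPositive_of_QN_nonneg_taylor hφ hx0 hx1 hpair (N := N) hℓΔ (by linarith)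
      (hCℓ ℓ hℓ hℓ0 Δ hℓΔ hΔE)
  · exact fun ℓ _ Δ hℓΔ hE => high_nonneg_of_pairPositive_taylor hφ hx0 hx1 hpair ℓ Δ hℓΔ hE

/-- **Kind `box` at `(1/2,1/2)`, explicit form — the obligations record.** For
`φ = taylorFunctional2D (1/2) S w`, threshold `E₀`, truncation order `N ≥ E₀` and a box with `e₁ ≥ 0`:
(I), (R) as above, (E) `φ[F_-[Q_N(Δ)]] ≥ 0` at `ℓ = 0` on `[e₁, e₂]`, (C′) at `ℓ = 0` on `[G, E₀)`
(`G ≥ 0`), at `ℓ = 2` on `[2+δ, E₀)` (`δ ≥ 0`), at even `ℓ ≥ 4` on `[ℓ, E₀)`, and (T) at `(2, 2)`, give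
`BoxObligations φ s G δ e₁ e₂ E₀`. PROVED. [cite: RattazziEtAl2008, §5.5] -/
theorem boxObligations_half_of_explicit (S : Finset (ℕ × ℕ)) (w : ℕ × ℕ → ℝ)
    {s G δ e₁ e₂ E₀ : ℝ} (N : ℕ) (hN : E₀ ≤ N) (he₁ : 0 ≤ e₁) (hG0 : 0 ≤ G) (hδ : 0 ≤ δ)
    (hI : 0 < taylorFunctional2D (1 / 2) S w (crossF s (-1) (fun _ _ => (1 : ℝ))))
    (hR : ∀ (b : ℝ) (J : ℕ), 0 ≤ b → E₀ ≤ 2 * b + J →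
      0 ≤ ∑ p ∈ S, w p * ((1 - (-1 : ℝ) ^ (p.1 + p.2)) * 2 ^ (p.1 + p.2) *
        (qFactor₁ s (b + J) p.1 * qFactor₁ s b p.2 + qFactor₁ s b p.1 * qFactor₁ s (b + J) p.2)))
    (hE : ∀ Δ : ℝ, e₁ ≤ Δ → Δ ≤ e₂ →
      0 ≤ taylorFunctional2D (1 / 2) S w (crossF s (-1) (QN N 0 Δ)))
    (hC0 : ∀ Δ : ℝ, G ≤ Δ → Δ < E₀ →
      0 ≤ taylorFunctional2D (1 / 2) S w (crossF s (-1) (QN N 0 Δ)))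
    (hT : 0 ≤ taylorFunctional2D (1 / 2) S w (crossF s (-1) (QN N 2 2)))
    (hC2 : ∀ Δ : ℝ, 2 + δ ≤ Δ → Δ < E₀ →
      0 ≤ taylorFunctional2D (1 / 2) S w (crossF s (-1) (QN N 2 Δ)))
    (hCℓ : ∀ ℓ : ℕ, Even ℓ → ℓ ≠ 0 → ℓ ≠ 2 → ∀ Δ : ℝ, (ℓ : ℝ) ≤ Δ → Δ < E₀ →
      0 ≤ taylorFunctional2D (1 / 2) S w (crossF s (-1) (QN N ℓ Δ))) :
    BoxObligations (taylorFunctional2D (1 / 2) S w) s G δ e₁ e₂ E₀ := by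
  have hφ := isTaylorFunctional_taylorFunctional2D (1 / 2) S w
  have hx0 : (0 : ℝ) < 1 / 2 := by norm_num
  have hx1 : (1 / 2 : ℝ) < 1 := by norm_num
  have hpair : PairPositiveAbove (taylorFunctional2D (1 / 2) S w) s E₀ :=
    pairPositiveAbove_half_of_poly S w hR
  -- every obligation below `E₀` by truncation; a cell point with `Δ ≥ E₀` directly by (R)
  have hcell : ∀ (ℓ : ℕ) (Δ : ℝ), (ℓ : ℝ) ≤ Δ →
      0 ≤ taylorFunctional2D (1 / 2) S w (crossF s (-1) (QN N ℓ Δ)) →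
      BlockPositive (taylorFunctional2D (1 / 2) S w) s Δ ℓ := by
    intro ℓ Δ hℓΔ hQ
    rcases le_or_gt E₀ Δ with hge | hlt
    · exact high_nonneg_of_pairPositive_taylor hφ hx0 hx1 hpair ℓ Δ hℓΔ hge
    · have : (0 : ℝ) ≤ ℓ := Nat.cast_nonneg ℓ
      exact blockPositive_of_QN_nonneg_taylor hφ hx0 hx1 hpair (N := N) hℓΔ (by linarith) hQ
  refine ⟨hI, ?_, ?_, ?_, ?_, ?_, ?_⟩
  · intro Δ h1 h2
    exact hcell 0 Δ (by simp only [Nat.cast_zero]; linarith) (hE Δ h1 h2)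
  · intro Δ h1 h2
    exact hcell 0 Δ (by simp only [Nat.cast_zero]; linarith) (hC0 Δ h1 h2)
  · exact hcell 2 2 (by norm_num) hT
  · intro Δ h1 h2
    exact hcell 2 Δ (by push_cast; linarith) (hC2 Δ h1 h2)
  · intro ℓ hℓ hℓ0 hℓ2 Δ hℓΔ hΔE
    exact hcell ℓ Δ hℓΔ (hCℓ ℓ hℓ hℓ0 hℓ2 Δ hℓΔ hΔE)
  · exact fun ℓ _ Δ hℓΔ hge => high_nonneg_of_pairPositive_taylor hφ hx0 hx1 hpair ℓ Δ hℓΔ hge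

/-- **Kind `box` at `(1/2,1/2)`, explicit form ⇒ location-wise exclusion of the whole box** (what the
class-1 cover consumes), for `G > 2s`, `s < 1`, any box with `e₁ ≥ 0`. PROVED
(`boxObligations_half_of_explicit` + `BoxObligations.excludedOn_taylor`). [cite: RattazziEtAl2008, §5.5] -/
theorem excludedOn_half_of_explicit (S : Finset (ℕ × ℕ)) (w : ℕ × ℕ → ℝ)
    {s G δ e₁ e₂ E₀ : ℝ} (N : ℕ) (hs1 : s < 1) (hG : 2 * s < G) (hN : E₀ ≤ N) (he₁ : 0 ≤ e₁)
    (hG0 : 0 ≤ G) (hδ : 0 ≤ δ)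
    (hI : 0 < taylorFunctional2D (1 / 2) S w (crossF s (-1) (fun _ _ => (1 : ℝ))))
    (hR : ∀ (b : ℝ) (J : ℕ), 0 ≤ b → E₀ ≤ 2 * b + J →
      0 ≤ ∑ p ∈ S, w p * ((1 - (-1 : ℝ) ^ (p.1 + p.2)) * 2 ^ (p.1 + p.2) *
        (qFactor₁ s (b + J) p.1 * qFactor₁ s b p.2 + qFactor₁ s b p.1 * qFactor₁ s (b + J) p.2)))
    (hE : ∀ Δ : ℝ, e₁ ≤ Δ → Δ ≤ e₂ →
      0 ≤ taylorFunctional2D (1 / 2) S w (crossF s (-1) (QN N 0 Δ)))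
    (hC0 : ∀ Δ : ℝ, G ≤ Δ → Δ < E₀ →
      0 ≤ taylorFunctional2D (1 / 2) S w (crossF s (-1) (QN N 0 Δ)))
    (hT : 0 ≤ taylorFunctional2D (1 / 2) S w (crossF s (-1) (QN N 2 2)))
    (hC2 : ∀ Δ : ℝ, 2 + δ ≤ Δ → Δ < E₀ →
      0 ≤ taylorFunctional2D (1 / 2) S w (crossF s (-1) (QN N 2 Δ)))
    (hCℓ : ∀ ℓ : ℕ, Even ℓ → ℓ ≠ 0 → ℓ ≠ 2 → ∀ Δ : ℝ, (ℓ : ℝ) ≤ Δ → Δ < E₀ →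
      0 ≤ taylorFunctional2D (1 / 2) S w (crossF s (-1) (QN N ℓ Δ))) :
    ExcludedOn s G δ (Icc e₁ e₂) :=
  (boxObligations_half_of_explicit S w N hN he₁ hG0 hδ hI hR hE hC0 hT hC2 hCℓ).excludedOn_taylor
    (isTaylorFunctional_taylorFunctional2D (1 / 2) S w) (by norm_num) (by norm_num) hG hs1

/-- **Kind `box` at `(1/2,1/2)`, explicit form ⇒ `BoxExcluded`** for boxes above `2s` (`e₁ > 2s`,
`G > 2s`, `s < 1`; `e₁ ≥ 0` then follows only if `s ≥ 0`, so it is kept as a hypothesis). PROVED.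
[cite: RattazziEtAl2008, §5.5] -/
theorem boxExcluded_half_of_explicit (S : Finset (ℕ × ℕ)) (w : ℕ × ℕ → ℝ)
    {s G δ e₁ e₂ E₀ : ℝ} (N : ℕ) (hs1 : s < 1) (he : 2 * s < e₁) (hG : 2 * s < G) (hN : E₀ ≤ N)
    (he₁ : 0 ≤ e₁) (hG0 : 0 ≤ G) (hδ : 0 ≤ δ)
    (hI : 0 < taylorFunctional2D (1 / 2) S w (crossF s (-1) (fun _ _ => (1 : ℝ))))
    (hR : ∀ (b : ℝ) (J : ℕ), 0 ≤ b → E₀ ≤ 2 * b + J →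
      0 ≤ ∑ p ∈ S, w p * ((1 - (-1 : ℝ) ^ (p.1 + p.2)) * 2 ^ (p.1 + p.2) *
        (qFactor₁ s (b + J) p.1 * qFactor₁ s b p.2 + qFactor₁ s b p.1 * qFactor₁ s (b + J) p.2)))
    (hE : ∀ Δ : ℝ, e₁ ≤ Δ → Δ ≤ e₂ →
      0 ≤ taylorFunctional2D (1 / 2) S w (crossF s (-1) (QN N 0 Δ)))
    (hC0 : ∀ Δ : ℝ, G ≤ Δ → Δ < E₀ →
      0 ≤ taylorFunctional2D (1 / 2) S w (crossF s (-1) (QN N 0 Δ)))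
    (hT : 0 ≤ taylorFunctional2D (1 / 2) S w (crossF s (-1) (QN N 2 2)))
    (hC2 : ∀ Δ : ℝ, 2 + δ ≤ Δ → Δ < E₀ →
      0 ≤ taylorFunctional2D (1 / 2) S w (crossF s (-1) (QN N 2 Δ)))
    (hCℓ : ∀ ℓ : ℕ, Even ℓ → ℓ ≠ 0 → ℓ ≠ 2 → ∀ Δ : ℝ, (ℓ : ℝ) ≤ Δ → Δ < E₀ →
      0 ≤ taylorFunctional2D (1 / 2) S w (crossF s (-1) (QN N ℓ Δ))) :
    BoxExcluded s G δ e₁ e₂ :=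
  (boxObligations_half_of_explicit S w N hN he₁ hG0 hδ hI hR hE hC0 hT hC2 hCℓ).boxExcluded_taylor
    (isTaylorFunctional_taylorFunctional2D (1 / 2) S w) (by norm_num) (by norm_num) he hG hs1

end Summit.CriticalPhenomena.Ising3D.Control2D
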